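import Summits.NavierStokesRegularity.NavierStokesRegularity.Theorems.HardyPointSinkHardyBalanceLawLimits
import Literature.Analysis.PDE.NewtonianPotentialRegularity
import HarnessLib

/-!
# Route HardyPointSink — `HardyEnergyBound`: limits for the localised Hardy identity

Helper file for the crux item stmt-NavierStokesRegularity-7979 (`HardyEnergyBound`), stub
`stub_localHardyIdentity` of the line `birth`: the local energy identity of a classical
Navier–Stokes solution tested against the singular weight `φ(x)/|x - x₀|` with `φ ∈ C_c^∞(ℝ³)`.
The proof regularises the weight as `ψₙ(x) = regKernel aₙ (x - x₀) φ(x)`, `aₙ = (n+1)⁻²`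
(`regKernel a ξ = (‖ξ‖² + a)^{-1/2}` in `ℝ³`), and lets `n → ∞`. This file collects the
`n → ∞` limits of the pieces of the resulting flux, specialised from the global-weight versions
of `…HardyBalanceLawLimits` (there the cut-offs `χₙ → 1`; here there is no cut-off, the compact
support of `φ` replaces the decay of the solution):

* the Hardy-weight terms `∫ G · regKernel aₙ (· - x₀) → ∫ G/|x - x₀|` and the flux terms
  `∫ (‖x - x₀‖² + aₙ)^{-3/2} W → ∫ W/|x - x₀|³`, with uniform bounds and the integrability of
  the limits, for continuous `G = O((1+‖x‖)⁻⁴)`, `W = O((1+‖x‖)⁻²|x - x₀|)`;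
* the point sink `∫ regBump aₙ (x - x₀) g(x) dx → 4π g(x₀)` for a continuous compactly
  supported `g` (approximate identity of mass `bumpMass ℝ³ = 4π`);
* the conversion of "bounded and supported in `B̄(0, R)`" into the weighted bounds above;
* the pointwise splitting of the flux integrand of `ψₙ = regKernel aₙ (· - x₀) φ` into the five
  pieces (Leibniz rules of `…HardyBalanceLawLimits`, and `Σᵢ ∂ᵢ regKernel · ∂ᵢφ = -ρₐ Dφ(x - x₀)`);
* interval integrability of a bounded pointwise limit of continuous functions of time.

## References

* L. Caffarelli, R. Kohn, L. Nirenberg, CPAM 35 (1982), §2; D. Gilbarg, N. Trudinger, (2.12)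
  (`Δ(1/r) = -4πδ` in `ℝ³`); G. Seregin, *Lecture notes on regularity theory for the
  Navier–Stokes equations* (2014), p. 113.
-/

noncomputable section

open MeasureTheory Metric Set Filter Topology TopologicalSpace Function InnerProductSpace
open Literature.Analysis.PDE Literature.Analysis.FluidPDE
open scoped RealInnerProductSpace Laplacian NNReal Interval ContDiff

set_option linter.dupNamespace false -- nested layout Summit.<S>.<Sub>, Sub = S (D-0017)

namespace Summit.NavierStokesRegularity.NavierStokesRegularity.Theorems

/-! ### From compact support to the polynomial weights -/

/-- On `‖x‖ ≤ R`: `1 ≤ (1 + R)^k (1 + ‖x‖)^{-k}`. -/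
theorem hardyEnergyBound_localHardyIdentity_one_le_weight (k : ℕ) {R : ℝ}
    {x : EuclideanSpace ℝ (Fin 3)} (hx : ‖x‖ ≤ R) :
    1 ≤ (1 + R) ^ k * ((1 + ‖x‖) ^ k)⁻¹ := by
  rw [← div_eq_mul_inv, one_le_div (by positivity)]
  exact pow_le_pow_left₀ (by positivity) (by linarith) k

/-- A function bounded by `M` on a set `T ⊆ B̄(0, R)` and vanishing off `T` is
`O((1 + ‖x‖)⁻⁴)`: `|G x| ≤ M (1 + R)⁴ (1 + ‖x‖)⁻⁴`. -/
theorem hardyEnergyBound_localHardyIdentity_bound_G {T : Set (EuclideanSpace ℝ (Fin 3))}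
    {R M : ℝ} (hR : 0 ≤ R) (hM : 0 ≤ M) (hT : T ⊆ closedBall (0 : EuclideanSpace ℝ (Fin 3)) R)
    {G : EuclideanSpace ℝ (Fin 3) → ℝ} (h1 : ∀ x ∈ T, |G x| ≤ M) (h0 : ∀ x, x ∉ T → G x = 0)
    (x : EuclideanSpace ℝ (Fin 3)) :
    |G x| ≤ M * (1 + R) ^ 4 * ((1 + ‖x‖) ^ 4)⁻¹ := by
  by_cases hx : x ∈ T
  · have hxR : ‖x‖ ≤ R := mem_closedBall_zero_iff.1 (hT hx)
    have hw := hardyEnergyBound_localHardyIdentity_one_le_weight 4 hxR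
    calc |G x| ≤ M * 1 := by rw [mul_one]; exact h1 x hx
      _ ≤ M * ((1 + R) ^ 4 * ((1 + ‖x‖) ^ 4)⁻¹) := mul_le_mul_of_nonneg_left hw hM
      _ = M * (1 + R) ^ 4 * ((1 + ‖x‖) ^ 4)⁻¹ := by ring
  · rw [h0 x hx, abs_zero]
    have h1R : (0 : ℝ) ≤ 1 + R := by linarith
    exact mul_nonneg (mul_nonneg hM (pow_nonneg h1R 4)) (by positivity)

/-- A function bounded by `M |x - x₀|` on a set `T ⊆ B̄(0, R)` and vanishing off `T` satisfies
`|W x| ≤ M (1 + R)² (1 + ‖x‖)⁻² |x - x₀|`. -/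
theorem hardyEnergyBound_localHardyIdentity_bound_W (x₀ : EuclideanSpace ℝ (Fin 3))
    {T : Set (EuclideanSpace ℝ (Fin 3))} {R M : ℝ} (hR : 0 ≤ R) (hM : 0 ≤ M)
    (hT : T ⊆ closedBall (0 : EuclideanSpace ℝ (Fin 3)) R) {W : EuclideanSpace ℝ (Fin 3) → ℝ}
    (h1 : ∀ x ∈ T, |W x| ≤ M * ‖x - x₀‖) (h0 : ∀ x, x ∉ T → W x = 0)
    (x : EuclideanSpace ℝ (Fin 3)) :
    |W x| ≤ M * (1 + R) ^ 2 * ((1 + ‖x‖) ^ 2)⁻¹ * ‖x - x₀‖ := by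
  by_cases hx : x ∈ T
  · have hxR : ‖x‖ ≤ R := mem_closedBall_zero_iff.1 (hT hx)
    have hw := hardyEnergyBound_localHardyIdentity_one_le_weight 2 hxR
    have h2 : 0 ≤ M * ‖x - x₀‖ := mul_nonneg hM (norm_nonneg _)
    calc |W x| ≤ M * ‖x - x₀‖ * 1 := by rw [mul_one]; exact h1 x hx
      _ ≤ M * ‖x - x₀‖ * ((1 + R) ^ 2 * ((1 + ‖x‖) ^ 2)⁻¹) := mul_le_mul_of_nonneg_left hw h2
      _ = M * (1 + R) ^ 2 * ((1 + ‖x‖) ^ 2)⁻¹ * ‖x - x₀‖ := by ring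
  · rw [h0 x hx, abs_zero]
    have h1R : (0 : ℝ) ≤ 1 + R := by linarith
    exact mul_nonneg (mul_nonneg (mul_nonneg hM (pow_nonneg h1R 2)) (by positivity))
      (norm_nonneg _)

/-! ### The Hardy-weight and flux terms without cut-off -/

/-- **The Hardy-weight limit** (no cut-off): for a continuous `G` with `|G| ≤ B(1+‖x‖)⁻⁴`,
`∫ G · regKernel aₙ (· - x₀) → ∫ G/|x - x₀|` (`aₙ = (n+1)⁻²`), with the uniform bound
`B ∫ (1+‖x‖)⁻⁴|x - x₀|⁻¹` and the integrability of every term. -/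
theorem hardyEnergyBound_localHardyIdentity_weight_term (x₀ : EuclideanSpace ℝ (Fin 3))
    {G : EuclideanSpace ℝ (Fin 3) → ℝ} (hG : Continuous G) {B : ℝ}
    (hGB : ∀ x, |G x| ≤ B * ((1 + ‖x‖) ^ 4)⁻¹) :
    Tendsto (fun n : ℕ => ∫ x, G x * Newtonian.regKernel ((((n : ℝ) + 1)⁻¹) ^ 2) (x - x₀)) atTop
        (𝓝 (∫ x, G x / ‖x - x₀‖)) ∧
      (∀ n : ℕ, |∫ x, G x * Newtonian.regKernel ((((n : ℝ) + 1)⁻¹) ^ 2) (x - x₀)| ≤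
        B * ∫ x : EuclideanSpace ℝ (Fin 3), ((1 + ‖x‖) ^ 4)⁻¹ * ‖x - x₀‖⁻¹) ∧
      ∀ n : ℕ, Integrable
        (fun x => G x * Newtonian.regKernel ((((n : ℝ) + 1)⁻¹) ^ 2) (x - x₀)) := by
  have h := hardyPointSink_tendsto_weight_term x₀ hardyPointSink_seq_pos hardyPointSink_tendsto_seq
    (χ := fun _ _ => (1 : ℝ)) (fun _ => continuous_const) (fun _ _ => zero_le_one)
    (fun _ _ => le_rfl) (fun _ => Eventually.of_forall fun _ => rfl) hG hGB
  simpa only [mul_one] using h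

/-- **The flux-term limit** (no cut-off): for a continuous `W` with `|W| ≤ B(1+‖x‖)⁻²|x - x₀|`,
`∫ (‖x - x₀‖² + aₙ)^{-3/2} W → ∫ W/|x - x₀|³`, with the uniform bound
`B ∫ (1+‖x‖)⁻²|x - x₀|⁻²` and the integrability of every term. -/
theorem hardyEnergyBound_localHardyIdentity_flux_term (x₀ : EuclideanSpace ℝ (Fin 3))
    {W : EuclideanSpace ℝ (Fin 3) → ℝ} (hW : Continuous W) {B : ℝ}
    (hWB : ∀ x, |W x| ≤ B * ((1 + ‖x‖) ^ 2)⁻¹ * ‖x - x₀‖) :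
    Tendsto (fun n : ℕ => ∫ x, (‖x - x₀‖ ^ 2 + (((n : ℝ) + 1)⁻¹) ^ 2) ^ (-3 / 2 : ℝ) * W x)
        atTop (𝓝 (∫ x, W x / ‖x - x₀‖ ^ 3)) ∧
      (∀ n : ℕ, |∫ x, (‖x - x₀‖ ^ 2 + (((n : ℝ) + 1)⁻¹) ^ 2) ^ (-3 / 2 : ℝ) * W x| ≤
        B * ∫ x : EuclideanSpace ℝ (Fin 3), ((1 + ‖x‖) ^ 2)⁻¹ * (‖x - x₀‖ ^ 2)⁻¹) ∧
      ∀ n : ℕ, Integrable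
        (fun x => (‖x - x₀‖ ^ 2 + (((n : ℝ) + 1)⁻¹) ^ 2) ^ (-3 / 2 : ℝ) * W x) := by
  have h := hardyPointSink_tendsto_flux_term x₀ hardyPointSink_seq_pos hardyPointSink_tendsto_seq
    (χ := fun _ _ => (1 : ℝ)) (fun _ => continuous_const) (fun _ _ => zero_le_one)
    (fun _ _ => le_rfl) (fun _ => Eventually.of_forall fun _ => rfl) hW hWB
  simpa only [one_mul] using h

/-- The Hardy-weight limit is integrable: `G/|x - x₀| ∈ L¹` for `|G| ≤ B(1+‖x‖)⁻⁴` continuous. -/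
theorem hardyEnergyBound_localHardyIdentity_integrable_G_div (x₀ : EuclideanSpace ℝ (Fin 3))
    {G : EuclideanSpace ℝ (Fin 3) → ℝ} (hG : Continuous G) {B : ℝ}
    (hGB : ∀ x, |G x| ≤ B * ((1 + ‖x‖) ^ 4)⁻¹) :
    Integrable (fun x => G x / ‖x - x₀‖) := by
  have hm : Measurable fun x => G x / ‖x - x₀‖ := by fun_prop
  refine ((hardyPointSink_integrable_FA x₀).const_mul B).mono' hm.aestronglyMeasurable
    (Eventually.of_forall fun x => ?_)
  have h0 : 0 ≤ ‖x - x₀‖⁻¹ := inv_nonneg.2 (norm_nonneg _)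
  rw [Real.norm_eq_abs, abs_div, abs_of_nonneg (norm_nonneg _), div_eq_mul_inv]
  calc |G x| * ‖x - x₀‖⁻¹ ≤ B * ((1 + ‖x‖) ^ 4)⁻¹ * ‖x - x₀‖⁻¹ :=
        mul_le_mul_of_nonneg_right (hGB x) h0
    _ = B * (((1 + ‖x‖) ^ 4)⁻¹ * ‖x - x₀‖⁻¹) := by ring

/-- The flux-term limit is integrable: `W/|x - x₀|³ ∈ L¹` for `|W| ≤ B(1+‖x‖)⁻²|x - x₀|`
continuous. -/
theorem hardyEnergyBound_localHardyIdentity_integrable_W_div (x₀ : EuclideanSpace ℝ (Fin 3))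
    {W : EuclideanSpace ℝ (Fin 3) → ℝ} (hW : Continuous W) {B : ℝ}
    (hWB : ∀ x, |W x| ≤ B * ((1 + ‖x‖) ^ 2)⁻¹ * ‖x - x₀‖) :
    Integrable (fun x => W x / ‖x - x₀‖ ^ 3) := by
  have hm : Measurable fun x => W x / ‖x - x₀‖ ^ 3 := by fun_prop
  refine ((hardyPointSink_integrable_FC x₀).const_mul B).mono' hm.aestronglyMeasurable ?_
  filter_upwards [hardyPointSink_ae_ne x₀] with x hx
  have hr : 0 < ‖x - x₀‖ := norm_pos_iff.2 (sub_ne_zero.2 hx)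
  rw [Real.norm_eq_abs, abs_div, abs_of_nonneg (by positivity : (0 : ℝ) ≤ ‖x - x₀‖ ^ 3)]
  calc |W x| / ‖x - x₀‖ ^ 3 ≤ B * ((1 + ‖x‖) ^ 2)⁻¹ * ‖x - x₀‖ / ‖x - x₀‖ ^ 3 :=
        div_le_div_of_nonneg_right (hWB x) (by positivity)
    _ = B * (((1 + ‖x‖) ^ 2)⁻¹ * (‖x - x₀‖ ^ 2)⁻¹) := by
        field_simp

/-! ### The point sink against a compactly supported density -/

/-- **The point sink** (approximate identity with mass `4π`): for a continuous compactly
supported `g` with `|g| ≤ M`, `∫ regBump aₙ (x - x₀) g(x) dx → 4π g(x₀)` (`aₙ = (n+1)⁻²`), with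
the uniform bound `4π M` and the integrability of every term. -/
theorem hardyEnergyBound_localHardyIdentity_tendsto_sink (x₀ : EuclideanSpace ℝ (Fin 3))
    {g : EuclideanSpace ℝ (Fin 3) → ℝ} (hg : Continuous g) (hgs : HasCompactSupport g) {M : ℝ}
    (hM : ∀ x, |g x| ≤ M) :
    Tendsto (fun n : ℕ => ∫ x, Newtonian.regBump ((((n : ℝ) + 1)⁻¹) ^ 2) (x - x₀) * g x) atTop
        (𝓝 (4 * Real.pi * g x₀)) ∧
      (∀ n : ℕ, |∫ x, Newtonian.regBump ((((n : ℝ) + 1)⁻¹) ^ 2) (x - x₀) * g x| ≤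
        4 * Real.pi * M) ∧
      ∀ n : ℕ, Integrable
        (fun x => Newtonian.regBump ((((n : ℝ) + 1)⁻¹) ^ 2) (x - x₀) * g x) := by
  have hn3 := hardyPointSink_three_le_finrank
  have hA := hardyPointSink_bumpMass_fin_three
  have hApos : 0 < Newtonian.bumpMass (EuclideanSpace ℝ (Fin 3)) := Newtonian.bumpMass_pos hn3
  have hε : ∀ n : ℕ, (0 : ℝ) < ((n : ℝ) + 1)⁻¹ := fun n => by positivity
  -- rewrite the bump through the normalised approximate identity, reflected
  have hK : ∀ (n : ℕ) (x : EuclideanSpace ℝ (Fin 3)),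
      Newtonian.regBump ((((n : ℝ) + 1)⁻¹) ^ 2) (x - x₀) =
      Newtonian.bumpMass (EuclideanSpace ℝ (Fin 3)) *
        Newtonian.approxId ((((n : ℝ) + 1)⁻¹) ^ 2) (x₀ - x) := by
    intro n x
    rw [Newtonian.approxId, ← mul_assoc, mul_inv_cancel₀ hApos.ne', one_mul, ← neg_sub,
      hardyPointSink_regBump_neg]
  have hI : ∀ n : ℕ, ∫ x, Newtonian.regBump ((((n : ℝ) + 1)⁻¹) ^ 2) (x - x₀) * g x =
      Newtonian.bumpMass (EuclideanSpace ℝ (Fin 3)) *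
        ∫ x, g x * Newtonian.approxId ((((n : ℝ) + 1)⁻¹) ^ 2) (x₀ - x) := by
    intro n
    rw [← integral_const_mul]
    refine integral_congr_ae (Eventually.of_forall fun x => ?_)
    simp only [hK n x]
    ring
  -- the approximate identity
  have hgu : UniformContinuous g := hgs.uniformContinuous_of_continuous hg
  have hlim := (Newtonian.tendsto_integral_mul_approxId hn3 hg hgu hM x₀).comp
    Newtonian.tendsto_inv_succ_nhdsWithin
  have hKi : ∀ n : ℕ, Integrable fun x : EuclideanSpace ℝ (Fin 3) =>
      Newtonian.regBump ((((n : ℝ) + 1)⁻¹) ^ 2) (x - x₀) := fun n =>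
    (Newtonian.integrable_regBump_sq (hε n)).comp_sub_right x₀
  have hM0 : 0 ≤ M := (abs_nonneg _).trans (hM x₀)
  refine ⟨?_, fun n => ?_, fun n => ?_⟩
  · have h2 := hlim.const_mul (Newtonian.bumpMass (EuclideanSpace ℝ (Fin 3)))
    rw [hA] at h2
    refine h2.congr fun n => ?_
    simp only [Function.comp_def]
    rw [hI n, hA]
  · have hKi := hKi n
    have hKint : ∫ x : EuclideanSpace ℝ (Fin 3),
        Newtonian.regBump ((((n : ℝ) + 1)⁻¹) ^ 2) (x - x₀) = 4 * Real.pi := by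
      rw [integral_sub_right_eq_self
        (fun ξ : EuclideanSpace ℝ (Fin 3) => Newtonian.regBump ((((n : ℝ) + 1)⁻¹) ^ 2) ξ) x₀,
        Newtonian.integral_regBump_sq (hε n), hA]
    have hK0 : ∀ x : EuclideanSpace ℝ (Fin 3),
        0 ≤ Newtonian.regBump ((((n : ℝ) + 1)⁻¹) ^ 2) (x - x₀) := fun x =>
      hardyPointSink_regBump_nonneg (by positivity) _
    have hb : ∀ x : EuclideanSpace ℝ (Fin 3),
        ‖Newtonian.regBump ((((n : ℝ) + 1)⁻¹) ^ 2) (x - x₀) * g x‖ ≤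
        M * Newtonian.regBump ((((n : ℝ) + 1)⁻¹) ^ 2) (x - x₀) := fun x => by
      rw [Real.norm_eq_abs, abs_mul, abs_of_nonneg (hK0 x), mul_comm]
      exact mul_le_mul_of_nonneg_right (hM x) (hK0 x)
    calc |∫ x, Newtonian.regBump ((((n : ℝ) + 1)⁻¹) ^ 2) (x - x₀) * g x|
        ≤ ∫ x, M * Newtonian.regBump ((((n : ℝ) + 1)⁻¹) ^ 2) (x - x₀) := by
          rw [← Real.norm_eq_abs]
          exact norm_integral_le_of_norm_le (hKi.const_mul _) (Eventually.of_forall hb)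
      _ = 4 * Real.pi * M := by rw [integral_const_mul, hKint]; ring
  · have h := (hKi n).bdd_mul (c := M) hg.aestronglyMeasurable
      (Eventually.of_forall fun x => by rw [Real.norm_eq_abs]; exact hM x)
    simpa only [mul_comm] using h

/-- **The point sink, registered form**: for a continuous compactly supported density `g` on
`ℝ³` and any centre `x₀`, `∫ regBump aₙ (x - x₀) g(x) dx → 4π g(x₀)` along `aₙ = (n+1)⁻²`
(the Newtonian bump `regBump a = -Δ regKernel a` is an approximate identity of mass `4π`:
`Δ(1/r) = -4πδ` in `ℝ³`). -/
theorem hardyEnergyBound_localHardyIdentity_pointSink :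
    ∀ (x₀ : EuclideanSpace ℝ (Fin 3)) (g : EuclideanSpace ℝ (Fin 3) → ℝ), Continuous g →
      HasCompactSupport g →
      Filter.Tendsto (fun n : ℕ => ∫ x,
        Literature.Analysis.PDE.Newtonian.regBump ((((n : ℝ) + 1)⁻¹) ^ 2) (x - x₀) * g x)
        Filter.atTop (nhds (4 * Real.pi * g x₀)) := by
  intro x₀ g hg hgs
  obtain ⟨M, hM⟩ := hgs.exists_bound_of_continuous hg
  exact (hardyEnergyBound_localHardyIdentity_tendsto_sink x₀ hg hgs
    (M := M) (fun x => by rw [← Real.norm_eq_abs]; exact hM x)).1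

/-! ### Pointwise calculus of `ψₙ = regKernel aₙ (· - x₀) φ` -/

/-- `Σᵢ D(regKernel a (· - x₀))(x)(eᵢ) L(eᵢ) = -(‖x - x₀‖² + a)^{-3/2} L(x - x₀)` for a linear
form `L` and an orthonormal basis `(eᵢ)` of `ℝ³`. -/
theorem hardyEnergyBound_localHardyIdentity_sum_fderiv (x₀ : EuclideanSpace ℝ (Fin 3)) {a : ℝ}
    (ha : 0 < a) (L : EuclideanSpace ℝ (Fin 3) →L[ℝ] ℝ) (x : EuclideanSpace ℝ (Fin 3)) :
    ∑ i, fderiv ℝ (fun y : EuclideanSpace ℝ (Fin 3) => Newtonian.regKernel a (y - x₀)) x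
          (stdOrthonormalBasis ℝ (EuclideanSpace ℝ (Fin 3)) i) *
        L (stdOrthonormalBasis ℝ (EuclideanSpace ℝ (Fin 3)) i) =
      -(‖x - x₀‖ ^ 2 + a) ^ (-3 / 2 : ℝ) * L (x - x₀) := by
  set b := stdOrthonormalBasis ℝ (EuclideanSpace ℝ (Fin 3)) with hb
  have hsum : ∑ i, ⟪x - x₀, b i⟫ * L (b i) = L (x - x₀) := by
    conv_rhs => rw [← b.sum_repr' (x - x₀)]
    rw [map_sum]
    refine Finset.sum_congr rfl fun i _ => ?_
    rw [map_smul, smul_eq_mul, real_inner_comm]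
  rw [← hsum, Finset.mul_sum]
  refine Finset.sum_congr rfl fun i _ => ?_
  rw [hardyPointSink_fderiv_weight_apply ha x₀ x (b i)]
  ring

/-- **The pointwise splitting of the flux integrand of `ψ = regKernel a (· - x₀) φ`** into the
Hardy-weight Laplacian term, the cross term, the point sink, the head term and the head flux:
with `K = regKernel a (x - x₀)`, `ρ = (‖x - x₀‖² + a)^{-3/2}`,
`νΔψ|v|² + Dψ(v)|v|² + 2qDψ(v) = ν(Δφ|v|²)K - 2ν ρ(Dφ(x-x₀)|v|²) - ν regBump a (x-x₀)(φ|v|²)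
  + (Dφ(v)(|v|²+2q))K - ρ(φ⟨x-x₀,v⟩(|v|²+2q))`. -/
theorem hardyEnergyBound_localHardyIdentity_integrand_eq (x₀ : EuclideanSpace ℝ (Fin 3)) (ν : ℝ)
    {a : ℝ} (ha : 0 < a) {φ : EuclideanSpace ℝ (Fin 3) → ℝ} (hφ : ContDiff ℝ 2 φ)
    (v : EuclideanSpace ℝ (Fin 3) → EuclideanSpace ℝ (Fin 3)) (q : EuclideanSpace ℝ (Fin 3) → ℝ)
    (x : EuclideanSpace ℝ (Fin 3)) :
    ν * ((Δ (fun y => Newtonian.regKernel a (y - x₀) * φ y)) x * ‖v x‖ ^ 2) +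
        fderiv ℝ (fun y => Newtonian.regKernel a (y - x₀) * φ y) x (v x) * ‖v x‖ ^ 2 +
        2 * (q x * fderiv ℝ (fun y => Newtonian.regKernel a (y - x₀) * φ y) x (v x)) =
      ν * ((Δ φ) x * ‖v x‖ ^ 2 * Newtonian.regKernel a (x - x₀)) -
      2 * ν * ((‖x - x₀‖ ^ 2 + a) ^ (-3 / 2 : ℝ) * (fderiv ℝ φ x (x - x₀) * ‖v x‖ ^ 2)) -
      ν * (Newtonian.regBump a (x - x₀) * (φ x * ‖v x‖ ^ 2)) +
      fderiv ℝ φ x (v x) * (‖v x‖ ^ 2 + 2 * q x) * Newtonian.regKernel a (x - x₀) -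
      (‖x - x₀‖ ^ 2 + a) ^ (-3 / 2 : ℝ) * (φ x * (⟪x - x₀, v x⟫ * (‖v x‖ ^ 2 + 2 * q x))) := by
  rw [hardyPointSink_laplacian_psi x₀ ha hφ x,
    hardyPointSink_fderiv_psi x₀ ha (hφ.of_le one_le_two) x (v x),
    hardyEnergyBound_localHardyIdentity_sum_fderiv x₀ ha (fderiv ℝ φ x) x]
  ring

/-- Splitting the integral of the five-piece integrand. -/
theorem hardyEnergyBound_localHardyIdentity_integral_five
    {f₁ f₂ f₃ f₄ f₅ : EuclideanSpace ℝ (Fin 3) → ℝ}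
    (h₁ : Integrable f₁) (h₂ : Integrable f₂) (h₃ : Integrable f₃) (h₄ : Integrable f₄)
    (h₅ : Integrable f₅) (c₁ c₂ c₃ : ℝ) :
    ∫ x, (c₁ * f₁ x - c₂ * f₂ x - c₃ * f₃ x + f₄ x - f₅ x) =
      c₁ * (∫ x, f₁ x) - c₂ * (∫ x, f₂ x) - c₃ * (∫ x, f₃ x) + (∫ x, f₄ x) - ∫ x, f₅ x := by
  have g₁ : Integrable (fun x => c₁ * f₁ x) := h₁.const_mul c₁
  have g₂ : Integrable (fun x => c₂ * f₂ x) := h₂.const_mul c₂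
  have g₃ : Integrable (fun x => c₃ * f₃ x) := h₃.const_mul c₃
  have g₁₂ : Integrable (fun x => c₁ * f₁ x - c₂ * f₂ x) := g₁.sub g₂
  have g₁₂₃ : Integrable (fun x => c₁ * f₁ x - c₂ * f₂ x - c₃ * f₃ x) := g₁₂.sub g₃
  have g₁₂₃₄ : Integrable (fun x => c₁ * f₁ x - c₂ * f₂ x - c₃ * f₃ x + f₄ x) := g₁₂₃.add h₄
  rw [integral_sub g₁₂₃₄ h₅, integral_add g₁₂₃ h₄, integral_sub g₁₂ g₃, integral_sub g₁ g₂,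
    integral_const_mul, integral_const_mul, integral_const_mul]

/-- `|t₁ - t₂ - t₃ + t₄ - t₅ - t₆| ≤ |t₁| + |t₂| + |t₃| + |t₄| + |t₅| + |t₆|`. -/
theorem hardyEnergyBound_localHardyIdentity_abs_six_le (t₁ t₂ t₃ t₄ t₅ t₆ : ℝ) :
    |t₁ - t₂ - t₃ + t₄ - t₅ - t₆| ≤ |t₁| + |t₂| + |t₃| + |t₄| + |t₅| + |t₆| := by
  rw [abs_le]
  constructor <;> linarith [neg_abs_le t₁, le_abs_self t₁, neg_abs_le t₂, le_abs_self t₂,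
    neg_abs_le t₃, le_abs_self t₃, neg_abs_le t₄, le_abs_self t₄, neg_abs_le t₅, le_abs_self t₅,
    neg_abs_le t₆, le_abs_self t₆]

/-- The six-term bound with the viscosity coefficients. -/
theorem hardyEnergyBound_localHardyIdentity_six_bound
    {ν t₁ t₂ t₃ t₄ t₅ t₆ b₁ b₂ b₃ b₄ b₅ b₆ : ℝ}
    (h₁ : |t₁| ≤ b₁) (h₂ : |t₂| ≤ b₂) (h₃ : |t₃| ≤ b₃) (h₄ : |t₄| ≤ b₄) (h₅ : |t₅| ≤ b₅)
    (h₆ : |t₆| ≤ b₆) :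
    |ν * t₁ - 2 * ν * t₂ - ν * t₃ + t₄ - t₅ - 2 * ν * t₆| ≤
      |ν| * b₁ + 2 * |ν| * b₂ + |ν| * b₃ + b₄ + b₅ + 2 * |ν| * b₆ := by
  have hν : 0 ≤ |ν| := abs_nonneg ν
  have a₁ : |ν * t₁| ≤ |ν| * b₁ := by
    rw [abs_mul]; exact mul_le_mul_of_nonneg_left h₁ hν
  have a₂ : |2 * ν * t₂| ≤ 2 * |ν| * b₂ := by
    rw [abs_mul, abs_mul, abs_two]; exact mul_le_mul_of_nonneg_left h₂ (by positivity)
  have a₃ : |ν * t₃| ≤ |ν| * b₃ := by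
    rw [abs_mul]; exact mul_le_mul_of_nonneg_left h₃ hν
  have a₆ : |2 * ν * t₆| ≤ 2 * |ν| * b₆ := by
    rw [abs_mul, abs_mul, abs_two]; exact mul_le_mul_of_nonneg_left h₆ (by positivity)
  have key := hardyEnergyBound_localHardyIdentity_abs_six_le (ν * t₁) (2 * ν * t₂) (ν * t₃) t₄ t₅
    (2 * ν * t₆)
  linarith

/-! ### A bounded pointwise limit of continuous functions of time is interval integrable -/

/-- If continuous functions `Fₙ` on `S ⊇ Ι a b` are uniformly bounded on `Ι a b` and converge
pointwise there to `f`, then `f` is interval integrable on `[a, b]`. -/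
theorem hardyEnergyBound_localHardyIdentity_intervalIntegrable_of_tendsto {F : ℕ → ℝ → ℝ}
    {f : ℝ → ℝ} {a b M : ℝ} {S : Set ℝ} (hS : Ι a b ⊆ S) (hF : ∀ n, ContinuousOn (F n) S)
    (hb : ∀ n, ∀ s ∈ Ι a b, |F n s| ≤ M)
    (hlim : ∀ s ∈ Ι a b, Tendsto (fun n => F n s) atTop (𝓝 (f s))) :
    IntervalIntegrable f volume a b := by
  have hmeas : ∀ n, AEStronglyMeasurable (F n) (volume.restrict (Ι a b)) := fun n =>
    ((hF n).mono hS).aestronglyMeasurable measurableSet_uIoc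
  have hlim' : ∀ᵐ s ∂(volume.restrict (Ι a b)), Tendsto (fun n => F n s) atTop (𝓝 (f s)) :=
    (ae_restrict_iff' measurableSet_uIoc).2 (Eventually.of_forall hlim)
  have hf : AEStronglyMeasurable f (volume.restrict (Ι a b)) :=
    aestronglyMeasurable_of_tendsto_ae atTop hmeas hlim'
  refine (intervalIntegrable_const (c := M)).mono_fun' hf ?_
  refine (ae_restrict_iff' measurableSet_uIoc).2 (Eventually.of_forall fun s hs => ?_)
  show ‖f s‖ ≤ M
  rw [Real.norm_eq_abs]
  exact le_of_tendsto' ((hlim s hs).abs) fun n => hb n s hs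

end Summit.NavierStokesRegularity.NavierStokesRegularity.Theorems

end
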